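import Literature.NumberTheory.EllipticCurves.LatticeJInvariant
import Mathlib.NumberTheory.ModularForms.LevelOne.GradedRing
import Mathlib.NumberTheory.Modular
import HarnessLib

/-!
# Klein's modular invariant `j = E₄³/Δ` on `ℍ`: orbit criterion, zeros of `E₄`, `E₆`, and
  the level-one modular functions `ℂ(j)` (trunk EllArithM; layer 1 of the Riemann–Roch bridge
  to `dim S₂(Γ₀(N)) = g(X₀(N))`)

This file starts the function-field route to the dimension formula `dim_ℂ S₂(Γ₀(N)) = g(X₀(N))`
(the named fact `finrank_cuspForm_two_eq_genusX0` of `ModularCurve`, whose `≤` half is proved in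
`ModularCurveGenusBoundProofs` by Manin's modular symbols): the modular curve `X₀(N)` is replaced
by the algebraic function field `K_N/ℂ` of ratios of modular forms, to which the tree's
Riemann–Roch theorem (`DiophantineGeometry/FunctionFieldAdelesProofs.riemann_roch_holds`)
applies. Layer 1 is the geometry of `X(1)`, i.e. of **Klein's invariant**

* `kleinJ τ = E₄(τ)³/Δ(τ)` (`= 1728 E₄³/(E₄³ − E₆²) = q⁻¹ + 744 + …`), Mathlib's `E₄` and
  `Δ = η²⁴`; it is the `j`-invariant of the lattice `ℤτ + ℤ` (`kleinJ_eq_periodPair_j`, from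
  `PeriodPair.j_ofUpperHalfPlane` of `LatticeJInvariant`).

## Main statements (all proved)

* `kleinJ_smul`: `j(γτ) = j(τ)` for `γ ∈ SL₂(ℤ)`.
* `exists_sl2z_smul_eq_of_lattice_eq`: homothetic lattices `ℤτ₂ + ℤ = c(ℤτ₁ + ℤ)` have
  `SL₂(ℤ)`-equivalent `τ₁, τ₂` (Serre VII §2.2).
* `kleinJ_eq_kleinJ_iff`: **`j(τ₁) = j(τ₂) ↔ τ₂ ∈ SL₂(ℤ)τ₁`** — `j` is injective on
  `SL₂(ℤ)\ℍ` (Cox Thm. 10.9 / Thm. 11.2 via `PeriodPair.j_eq_iff`; classically Serre VII §3.3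
  Prop. 5 via the valence formula, which is thereby avoided);
  `kleinJ_surjective` (Serre VII §3.3 Prop. 5(c), from `exists_E₄_cube_eq_mul_discriminant`).
* `kleinJ_I = 1728`, `kleinJ_rho = 0`; `E₄_eq_zero_iff` (**the zeros of `E₄` are the orbit of
  `ρ`**), `E₆_eq_zero_iff` (**the zeros of `E₆` are the orbit of `i`**) (Serre VII §3.2).
* `kleinJ_aeval_ne_zero`: `j` is transcendental over `ℂ`; holomorphy/continuity of `j`.
* `exists_polynomial_eval_kleinJ_mul_discriminant_pow`: **`M_{12m}(SL₂(ℤ)) = {P(j)Δ^m : deg P ≤ m}`**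
  (Serre VII §3.3), and `exists_polynomial_mul_eval_kleinJ_eq`: ratios of level-one forms of
  equal weight `12m` are rational functions of `j` — the field of level-one modular functions
  is `ℂ(j)` (Serre VII §3.3 Prop. 6).

Everything is in `namespace Literature.ModularForms`. Mathlib (v4.32.0) has no named `j`-function on `ℍ`
(searched `kleinJ`, `jInvariant`, `ModularForm.j`): `kleinJ` is new; `PeriodPair.j` (lattices) is
the tree's (`LatticeJInvariant`).

## References

* J.-P. Serre, *A Course in Arithmetic*, GTM 7, Springer 1973, VII §2.2 Prop. 2–3, §3.2, §3.3
  Prop. 5, Prop. 6.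
* D. A. Cox, *Primes of the form x² + ny²*, 2nd ed., Wiley 2013, Thm. 10.9, §11.A, Thm. 11.2.
* F. Diamond, J. Shurman, *A first course in modular forms*, GTM 228, Springer 2005, §1.1,
  Prop. 3.5.1 (discussion of `ℂ(X(1)) = ℂ(j)`).
-/

noncomputable section

open UpperHalfPlane hiding I
open ModularForm EisensteinSeries SlashInvariantForm ModularFormClass
open scoped MatrixGroups Real Topology Manifold

namespace Literature.NumberTheory.EllipticCurves.ModularForms

/-! ### Definition and `SL₂(ℤ)`-invariance -/

/-- **Klein's absolute invariant** `j(τ) = E₄(τ)³/Δ(τ)` (`= 1728 E₄³/(E₄³ − E₆²) = q⁻¹ + 744 + …`)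
on the upper half plane, with Mathlib's normalised level-one Eisenstein series `E₄` and modular
discriminant `Δ = η²⁴` (Serre, *A Course in Arithmetic*, VII §3.3; Diamond–Shurman §1.1).
It is the `j`-invariant of the lattice `ℤτ + ℤ` (`kleinJ_eq_periodPair_j`). [folklore] -/
def kleinJ (τ : ℍ) : ℂ :=
  E₄ τ ^ 3 / ModularForm.discriminant τ

/-- `j(τ) = j(ℤτ + ℤ)`, the `j`-invariant of the lattice `Λ_τ` (Cox, §11.A). [folklore] -/
theorem kleinJ_eq_periodPair_j (τ : ℍ) : kleinJ τ = (PeriodPair.ofUpperHalfPlane τ).j :=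
  (PeriodPair.j_ofUpperHalfPlane τ).symm

/-- Transformation law of a level-one modular form under `SL₂(ℤ)`:
`f(γτ) = (cτ + d)^k f(τ)`. [folklore] -/
theorem levelOne_apply_smul {k : ℤ} (f : ModularForm 𝒮ℒ k) (γ : SL(2, ℤ)) (τ : ℍ) :
    f (γ • τ) = denom γ τ ^ k * f τ := by
  have : SlashInvariantFormClass (ModularForm 𝒮ℒ k) (CongruenceSubgroup.Gamma 1) k := by
    rw [CongruenceSubgroup.Gamma_one_coe_eq_SL]; infer_instance
  exact slash_action_eqn_SL'' f (CongruenceSubgroup.mem_Gamma_one γ) τ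

/-- `Δ(γτ) = (cτ + d)¹² Δ(τ)` for `γ ∈ SL₂(ℤ)`. [folklore] -/
theorem discriminant_apply_smul (γ : SL(2, ℤ)) (τ : ℍ) :
    ModularForm.discriminant (γ • τ) = denom γ τ ^ (12 : ℤ) * ModularForm.discriminant τ := by
  simpa using levelOne_apply_smul (ModularFormClass.modularForm CuspForm.discriminant) γ τ

/-- **`j` is `SL₂(ℤ)`-invariant**: `j(γτ) = j(τ)` (Serre VII §3.3 Prop. 5). [folklore] -/
theorem kleinJ_smul (γ : SL(2, ℤ)) (τ : ℍ) : kleinJ (γ • τ) = kleinJ τ := by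
  have h4 := levelOne_apply_smul E₄ γ τ
  have hd := denom_ne_zero γ τ
  have hΔ := ModularForm.discriminant_ne_zero τ
  rw [kleinJ, kleinJ, h4, discriminant_apply_smul, mul_pow, ← zpow_natCast, ← zpow_mul]
  norm_num
  field_simp

/-! ### Homothetic lattices `ℤτ + ℤ` and `SL₂(ℤ)`-equivalence -/

/-- `xτ + y = 0` with `x, y ∈ ℤ` and `τ ∈ ℍ` forces `x = y = 0` (`1, τ` are `ℝ`-independent).
[folklore] -/
theorem int_mul_coe_add_eq_zero {τ : ℍ} {x y : ℤ} (h : (x : ℂ) * τ + y = 0) : x = 0 ∧ y = 0 := by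
  have him := congrArg Complex.im h
  simp only [Complex.add_im, Complex.mul_im, Complex.intCast_re, Complex.intCast_im, zero_mul,
    add_zero, Complex.zero_im, UpperHalfPlane.coe_im, UpperHalfPlane.coe_re] at him
  have hx : x = 0 := by
    rcases mul_eq_zero.mp him with h0 | h0
    · exact_mod_cast h0
    · exact absurd h0 τ.im_pos.ne'
  subst hx
  simp only [Int.cast_zero, zero_mul, zero_add, Int.cast_eq_zero] at h
  exact ⟨rfl, h⟩

/-- The matrix `(a b; c d) ∈ SL₂(ℤ)` with prescribed entries. [folklore] -/
def sl2zMk (a b c d : ℤ) (h : a * d - b * c = 1) : SL(2, ℤ) :=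
  ⟨!![a, b; c, d], by rw [Matrix.det_fin_two_of]; linear_combination h⟩

/-- Action of `sl2zMk a b c d` on `ℍ`: `τ ↦ (aτ + b)/(cτ + d)`. [folklore] -/
theorem coe_sl2zMk_smul (a b c d : ℤ) (h : a * d - b * c = 1) (τ : ℍ) :
    ((sl2zMk a b c d h • τ : ℍ) : ℂ) = ((a : ℂ) * τ + b) / ((c : ℂ) * τ + d) := by
  rw [coe_specialLinearGroup_apply]
  simp [sl2zMk]

/-- **Homothetic lattices `Λ_{τ₂} = c Λ_{τ₁}` have `SL₂(ℤ)`-equivalent ratios**: `τ₂ = γτ₁`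
for some `γ ∈ SL₂(ℤ)` (Serre, *A Course in Arithmetic*, VII §2.2 Prop. 2, 3; Silverman AEC
C.12). Proof: `τ₂ = c(aτ₁ + b)`, `1 = c(c'τ₁ + d)` and conversely `cτ₁, c ∈ ℤτ₂ + ℤ` give an
integer matrix with integer inverse, of determinant `+1` since both points lie in `ℍ`. [folklore] -/
theorem exists_sl2z_smul_eq_of_lattice_eq {τ₁ τ₂ : ℍ} {c : ℂ} (hc : c ≠ 0)
    (h : (PeriodPair.ofUpperHalfPlane τ₂).lattice =
      ((PeriodPair.ofUpperHalfPlane τ₁).mulLeft c hc).lattice) :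
    ∃ γ : SL(2, ℤ), γ • τ₁ = τ₂ := by
  set L₁ := PeriodPair.ofUpperHalfPlane τ₁ with hL₁
  set L₂ := PeriodPair.ofUpperHalfPlane τ₂ with hL₂
  have hτ₂ : (τ₂ : ℂ) ∈ (L₁.mulLeft c hc).lattice := h ▸ L₂.ω₁_mem_lattice
  have h1 : (1 : ℂ) ∈ (L₁.mulLeft c hc).lattice := h ▸ L₂.ω₂_mem_lattice
  have hcτ₁ : c * τ₁ ∈ L₂.lattice := h ▸ (L₁.mulLeft c hc).ω₁_mem_lattice
  have hc1 : c * 1 ∈ L₂.lattice := h ▸ (L₁.mulLeft c hc).ω₂_mem_lattice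
  obtain ⟨a, b, hab⟩ := PeriodPair.mem_lattice.mp hτ₂
  obtain ⟨c', d, hcd⟩ := PeriodPair.mem_lattice.mp h1
  obtain ⟨p, q, hpq⟩ := PeriodPair.mem_lattice.mp hcτ₁
  obtain ⟨r, s, hrs⟩ := PeriodPair.mem_lattice.mp hc1
  simp only [PeriodPair.mulLeft_ω₁, PeriodPair.mulLeft_ω₂, PeriodPair.ofUpperHalfPlane_ω₁,
    PeriodPair.ofUpperHalfPlane_ω₂, hL₁, hL₂, mul_one] at hab hcd hpq hrs
  -- the relations `M'M = 1` for `M = (a b; c' d)`, `M' = (p q; r s)`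
  have e12 : ((p * a + q * c' - 1 : ℤ) : ℂ) * τ₁ + ((p * b + q * d : ℤ) : ℂ) = 0 := by
    have : c * (((p * a + q * c' - 1 : ℤ) : ℂ) * τ₁ + ((p * b + q * d : ℤ) : ℂ)) = 0 := by
      push_cast
      linear_combination (p : ℂ) * hab + (q : ℂ) * hcd + hpq
    simpa [hc] using this
  have e34 : ((r * a + s * c' : ℤ) : ℂ) * τ₁ + ((r * b + s * d - 1 : ℤ) : ℂ) = 0 := by
    have : c * (((r * a + s * c' : ℤ) : ℂ) * τ₁ + ((r * b + s * d - 1 : ℤ) : ℂ)) = 0 := by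
      push_cast
      linear_combination (r : ℂ) * hab + (s : ℂ) * hcd + hrs
    simpa [hc] using this
  obtain ⟨e1, e2⟩ := int_mul_coe_add_eq_zero e12
  obtain ⟨e3, e4⟩ := int_mul_coe_add_eq_zero e34
  have hdet : (p * s - q * r) * (a * d - b * c') = 1 := by
    linear_combination (r * b + s * d) * e1 - (r * a + s * c') * e2 + e4
  -- `w = c'τ₁ + d ≠ 0` and `τ₂ w = aτ₁ + b`
  have hw : (c' : ℂ) * τ₁ + d ≠ 0 := by
    intro h0
    have : c * ((c' : ℂ) * τ₁ + d) = 1 := by linear_combination hcd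
    rw [h0, mul_zero] at this
    exact zero_ne_one this
  have hτ₂w : (τ₂ : ℂ) * ((c' : ℂ) * τ₁ + d) = (a : ℂ) * τ₁ + b := by
    linear_combination ((a : ℂ) * τ₁ + b) * hcd - ((c' : ℂ) * τ₁ + d) * hab
  rcases Int.eq_one_or_neg_one_of_mul_eq_one (u := a * d - b * c') (v := p * s - q * r)
      (by linear_combination hdet) with hu | hu
  · refine ⟨sl2zMk a b c' d hu, UpperHalfPlane.ext ?_⟩
    rw [coe_sl2zMk_smul, div_eq_iff hw, hτ₂w]
  · -- determinant `-1` is impossible: `(-a -b; c' d)` would send `τ₁` to `-τ₂ ∉ ℍ`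
    exfalso
    have hu' : (-a) * d - (-b) * c' = 1 := by linear_combination -hu
    have him := (sl2zMk (-a) (-b) c' d hu' • τ₁).im_pos
    have hcoe : ((sl2zMk (-a) (-b) c' d hu' • τ₁ : ℍ) : ℂ) = -τ₂ := by
      rw [coe_sl2zMk_smul, div_eq_iff hw]
      push_cast
      linear_combination hτ₂w
    rw [← UpperHalfPlane.coe_im, hcoe, Complex.neg_im, UpperHalfPlane.coe_im] at him
    linarith [τ₂.im_pos]

/-! ### The orbit criterion `j(τ₁) = j(τ₂) ↔ τ₂ ∈ SL₂(ℤ)τ₁` and its consequences -/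

/-- **`j` separates `SL₂(ℤ)`-orbits**: `j(τ₁) = j(τ₂)` iff `τ₂ = γτ₁` for some `γ ∈ SL₂(ℤ)`
(Serre, *A Course in Arithmetic*, VII §3.3 Prop. 5 with §2.2 Prop. 3; Cox, Thm. 10.9 /
Thm. 11.2). Proof: `j(τ) = j(ℤτ + ℤ)` classifies lattices up to homothety
(`PeriodPair.j_eq_iff`), and homothetic lattices `ℤτ + ℤ` have `SL₂(ℤ)`-equivalent `τ`.
[cite: Cox2013, Thm. 10.9] -/
theorem kleinJ_eq_kleinJ_iff {τ₁ τ₂ : ℍ} : kleinJ τ₁ = kleinJ τ₂ ↔ ∃ γ : SL(2, ℤ), γ • τ₁ = τ₂ := by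
  refine ⟨fun h ↦ ?_, ?_⟩
  · rw [kleinJ_eq_periodPair_j, kleinJ_eq_periodPair_j, PeriodPair.j_eq_iff] at h
    obtain ⟨c, hc, hL⟩ := h
    exact exists_sl2z_smul_eq_of_lattice_eq hc hL
  · rintro ⟨γ, rfl⟩
    exact (kleinJ_smul γ τ₁).symm

/-- **`j : ℍ → ℂ` is surjective** (Serre VII §3.3 Prop. 5(c)): `E₄³ − cΔ` vanishes somewhere
for every `c` (`ModularForm.exists_E₄_cube_eq_mul_discriminant`). [folklore] -/
theorem kleinJ_surjective : Function.Surjective kleinJ := fun c ↦ by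
  obtain ⟨τ, hτ⟩ := ModularForm.exists_E₄_cube_eq_mul_discriminant c
  exact ⟨τ, by rw [kleinJ, hτ, mul_div_cancel_right₀ _ (ModularForm.discriminant_ne_zero τ)]⟩

/-- `j(i) = 1728` (Cox §10.C; Serre VII §3.3). [folklore] -/
theorem kleinJ_I : kleinJ UpperHalfPlane.I = 1728 := by
  rw [kleinJ_eq_periodPair_j, PeriodPair.j_ofUpperHalfPlane_I]

/-- `j(ρ) = 0`, `ρ = e^{2πi/3}` (Cox Exercise 10.17; Serre VII §3.3). [folklore] -/
theorem kleinJ_rho : kleinJ UpperHalfPlane.ρ = 0 := by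
  rw [kleinJ_eq_periodPair_j, PeriodPair.j_ofUpperHalfPlane_ρ]

/-- `j(τ) = 1728 ↔ τ ∈ SL₂(ℤ) · i`. [folklore] -/
theorem kleinJ_eq_1728_iff {τ : ℍ} : kleinJ τ = 1728 ↔ ∃ γ : SL(2, ℤ), γ • UpperHalfPlane.I = τ := by
  rw [← kleinJ_I, eq_comm, kleinJ_eq_kleinJ_iff]

/-- `j(τ) = 0 ↔ τ ∈ SL₂(ℤ) · ρ`. [folklore] -/
theorem kleinJ_eq_zero_iff {τ : ℍ} : kleinJ τ = 0 ↔ ∃ γ : SL(2, ℤ), γ • UpperHalfPlane.ρ = τ := by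
  rw [← kleinJ_rho, eq_comm, kleinJ_eq_kleinJ_iff]

/-- `E₄(τ) = 0 ↔ τ ∈ SL₂(ℤ) · ρ` — the zeros of `E₄` form the single orbit of `ρ`
(Serre VII §3.2, Cor. 2 of the valence formula; here from `j = E₄³/Δ` and the orbit criterion).
[folklore] -/
theorem E₄_eq_zero_iff {τ : ℍ} : E₄ τ = 0 ↔ ∃ γ : SL(2, ℤ), γ • UpperHalfPlane.ρ = τ := by
  rw [← kleinJ_eq_zero_iff, kleinJ, div_eq_zero_iff, or_iff_left (ModularForm.discriminant_ne_zero τ)]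
  exact ⟨fun h ↦ by simp [h], fun h ↦ pow_eq_zero_of_le (le_refl 3) h |> fun h' ↦ by
    simpa using (pow_eq_zero_iff (n := 3) (by norm_num)).mp h⟩

/-- `E₆(τ) = 0 ↔ τ ∈ SL₂(ℤ) · i` — the zeros of `E₆` form the single orbit of `i`
(Serre VII §3.2; from `1728Δ = E₄³ − E₆²`, so `E₆ = 0 ↔ j = 1728`). [folklore] -/
theorem E₆_eq_zero_iff {τ : ℍ} : E₆ τ = 0 ↔ ∃ γ : SL(2, ℤ), γ • UpperHalfPlane.I = τ := by
  rw [← kleinJ_eq_1728_iff, kleinJ, ModularForm.discriminant_eq_E₄_cube_sub_E₆_sq]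
  have hΔ := ModularForm.discriminant_ne_zero τ
  rw [ModularForm.discriminant_eq_E₄_cube_sub_E₆_sq] at hΔ
  have h' : E₄ τ ^ 3 - E₆ τ ^ 2 ≠ 0 := by
    intro h0; apply hΔ; rw [h0, zero_div]
  rw [div_div_eq_mul_div, div_eq_iff h']
  constructor
  · intro h; rw [h]; ring
  · intro h
    have : E₆ τ ^ 2 = 0 := by linear_combination (1 / 1728 : ℂ) * h
    exact (pow_eq_zero_iff two_ne_zero).mp this

/-- `j ∘ ofComplex` is holomorphic on the upper half plane. [folklore] -/
theorem differentiableOn_kleinJ : DifferentiableOn ℂ (kleinJ ∘ ofComplex) {z : ℂ | 0 < z.im} := by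
  have h4 : DifferentiableOn ℂ (E₄ ∘ ofComplex) {z : ℂ | 0 < z.im} :=
    UpperHalfPlane.mdifferentiable_iff.mp E₄.holo'
  have hΔ : DifferentiableOn ℂ (ModularForm.discriminant ∘ ofComplex) {z : ℂ | 0 < z.im} :=
    UpperHalfPlane.mdifferentiable_iff.mp CuspForm.discriminant.holo'
  exact (h4.pow 3).div hΔ fun z _ ↦ ModularForm.discriminant_ne_zero _

/-- `j` is holomorphic on `ℍ` (as an `MDifferentiable` function). [folklore] -/
theorem mdifferentiable_kleinJ : MDiff kleinJ :=
  UpperHalfPlane.mdifferentiable_iff.mpr differentiableOn_kleinJ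

/-- `j` is continuous on `ℍ`. [folklore] -/
theorem continuous_kleinJ : Continuous kleinJ := by
  unfold kleinJ
  exact (E₄.holo'.continuous.pow 3).div CuspForm.discriminant.holo'.continuous
    fun τ ↦ ModularForm.discriminant_ne_zero τ

/-- **`j` is transcendental over `ℂ`**: no nonzero polynomial vanishes on `j` (a nonconstant —
indeed surjective — function). [folklore] -/
theorem kleinJ_aeval_ne_zero {P : Polynomial ℂ} (hP : P ≠ 0) : (fun τ ↦ P.eval (kleinJ τ)) ≠ 0 := by
  intro h
  -- `P` has a non-root `c`; `c = j(τ)` for some `τ`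
  obtain ⟨c, hc⟩ : ∃ c : ℂ, ¬ P.IsRoot c := by
    by_contra! hall
    exact hP (Polynomial.eq_zero_of_infinite_isRoot P (Set.infinite_univ.mono fun c _ ↦ hall c))
  obtain ⟨τ, rfl⟩ := kleinJ_surjective c
  exact hc (congrFun h τ)

/-! ### Level one: `M_{12m} = ℂ[j]_{≤ m} Δ^m` and the modular functions `ℂ(j)` -/

/-- `E₄(τ)³ = j(τ) Δ(τ)`. [folklore] -/
theorem E₄_cube_eq_kleinJ_mul (τ : ℍ) : E₄ τ ^ 3 = kleinJ τ * ModularForm.discriminant τ := by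
  rw [kleinJ, div_mul_cancel₀ _ (ModularForm.discriminant_ne_zero τ)]

/-- The constant term of the `q`-expansion of `E₄^{n}` (as the modular form `E₄.pow n`) is `1`.
[folklore] -/
theorem qExpansion_coeff_zero_E₄_pow (n : ℕ) : (qExpansion 1 (E₄.pow n)).coeff 0 = 1 := by
  rw [ModularForm.qExpansion_pow one_pos one_mem_strictPeriods_SL,
    PowerSeries.coeff_zero_eq_constantCoeff_apply, map_pow,
    ← PowerSeries.coeff_zero_eq_constantCoeff_apply, E_qExpansion_coeff_zero (by norm_num) ⟨2, rfl⟩,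
    one_pow]

/-- **Level-one forms of weight `12m` are `P(j) Δ^m` with `deg P ≤ m`** (Serre, *A Course in
Arithmetic*, VII §3.3, proof of Prop. 6 / Cor. 2 of Thm. 4: `M_{12m} = ℂE₄^{3m} ⊕ Δ M_{12(m−1)}`,
inductively). [folklore] -/
theorem exists_polynomial_eval_kleinJ_mul_discriminant_pow (m : ℕ) :
    ∀ F : ModularForm 𝒮ℒ (12 * (m : ℤ)), ∃ P : Polynomial ℂ, P.natDegree ≤ m ∧
      ∀ τ, F τ = P.eval (kleinJ τ) * ModularForm.discriminant τ ^ m := by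
  induction m with
  | zero =>
    intro F
    obtain ⟨c, hc⟩ := ModularFormClass.levelOne_weight_zero_const (F.mcast (by simp))
    refine ⟨Polynomial.C c, by simp, fun τ ↦ ?_⟩
    have := congrFun hc τ
    simp only [coe_mcast, Function.const_apply] at this
    rw [this]; simp
  | succ m ih =>
    intro F
    -- subtract `c · E₄^{3(m+1)}` to kill the constant term
    set c : ℂ := (qExpansion 1 F).coeff 0 with hc
    set E : ModularForm 𝒮ℒ (12 * ((m + 1 : ℕ) : ℤ)) :=
      (E₄.pow (3 * (m + 1))).mcast (by push_cast; ring) with hE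
    set G : ModularForm 𝒮ℒ (12 * ((m + 1 : ℕ) : ℤ)) := F - c • E with hG
    have hG0 : (qExpansion 1 G).coeff 0 = 0 := by
      rw [hG, ModularForm.coe_sub, ModularForm.qExpansion_sub one_pos one_mem_strictPeriods_SL,
        IsGLPos.coe_smul, ModularForm.qExpansion_smul one_pos one_mem_strictPeriods_SL, map_sub,
        PowerSeries.coeff_smul, hE, ModularForm.qExpansion_mcast, qExpansion_coeff_zero_E₄_pow]
      simp [hc]
    -- `G = Δ · F₁` with `F₁` of weight `12m`
    set F₁ : ModularForm 𝒮ℒ (12 * (m : ℤ)) :=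
      (CuspForm.discriminantEquiv (toCuspForm G hG0)).mcast (by push_cast; ring) with hF₁
    obtain ⟨P₁, hP₁, hF₁eq⟩ := ih F₁
    refine ⟨P₁ + Polynomial.C c * Polynomial.X ^ (m + 1), ?_, fun τ ↦ ?_⟩
    · refine (Polynomial.natDegree_add_le _ _).trans (max_le (hP₁.trans m.le_succ) ?_)
      exact (Polynomial.natDegree_C_mul_le _ _).trans (by simp)
    · have h1 : G τ = ModularForm.discriminant τ * F₁ τ := by
        rw [hF₁, coe_mcast, ModularForm.discriminant_mul_discriminantEquiv_apply, toCuspForm_apply]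
      have h2 : F τ = G τ + c * E τ := by
        have := congrFun (congrArg DFunLike.coe hG) τ
        simp only [ModularForm.coe_sub, IsGLPos.coe_smul, Pi.sub_apply, Pi.smul_apply,
          smul_eq_mul] at this
        rw [this]; ring
      rw [h2, h1, hF₁eq τ, hE, coe_mcast, ModularForm.coe_pow, Pi.pow_apply, pow_mul,
        E₄_cube_eq_kleinJ_mul, Polynomial.eval_add, Polynomial.eval_mul, Polynomial.eval_C,
        Polynomial.eval_pow, Polynomial.eval_X]
      ring

/-- **Ratios of level-one forms of the same weight `12m` are rational functions of `j`**:
for `F, G ∈ M_{12m}(SL₂(ℤ))`, `G ≠ 0`, there are polynomials `P, Q`, `Q ≠ 0`, of degree `≤ m`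
with `F · Q(j) = G · P(j)` on `ℍ` (so `F/G = P(j)/Q(j)`): the field of level-one modular
functions is `ℂ(j)` (Serre VII §3.3 Prop. 6; Diamond–Shurman Prop. 3.5.1 discussion). Any
common weight can be made divisible by `12` (`F/G = F G¹¹/G¹²`). [folklore] -/
theorem exists_polynomial_mul_eval_kleinJ_eq (m : ℕ) (F G : ModularForm 𝒮ℒ (12 * (m : ℤ)))
    (hG : G ≠ 0) : ∃ P Q : Polynomial ℂ, Q ≠ 0 ∧ P.natDegree ≤ m ∧ Q.natDegree ≤ m ∧
      ∀ τ, F τ * Q.eval (kleinJ τ) = G τ * P.eval (kleinJ τ) := by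
  obtain ⟨P, hP, hF⟩ := exists_polynomial_eval_kleinJ_mul_discriminant_pow m F
  obtain ⟨Q, hQ, hGq⟩ := exists_polynomial_eval_kleinJ_mul_discriminant_pow m G
  refine ⟨P, Q, ?_, hP, hQ, fun τ ↦ ?_⟩
  · rintro rfl
    apply hG
    ext τ
    simp [hGq τ]
  · rw [hF τ, hGq τ]; ring

end Literature.NumberTheory.EllipticCurves.ModularForms

end
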